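import Literature.Probability.RandomPlanarGeometry.HexSAWSurfaceWallRenewalSlackTwoClassification
import HarnessLib

/-!
# Hexagonal-lattice SAWs at a surface: the vertical profile of a wall block with four down steps

For an irreducible positive wall bridge `ω ∈ ipwb n` (brick-wall frame of the honeycomb lattice, half-plane `Y ≤ 0`) with
exactly four down steps and four up steps, the down times `p₁ < p₂ < p₃ < p₄` and up times `r₁ < r₂ < r₃ < r₄` satisfy
`pᵢ < rᵢ` (the walk stays in `Y ≤ 0`), the walk begins with the rightward wall run `(i, 0)`, `i ≤ p₁` (`p₁ ≥ 1` odd),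
dives first at `(p₁, 0) → (p₁, −1)`, every other step is horizontal, and the height at time `t` is the number of up times
`< t` minus the number of down times `< t` (`profile_of_card_stepsD_eq_four`).  This is the four-down analogue of
`profile_of_card_stepsD_eq_two` / `profile_of_card_stepsD_eq_three` of `…SlackTwoClassification` (same proof), recorded as
the first tool for the four-down stratum of the slack-four census (`…SlackFourRow`: at length `6k + 4` with `k` visits the
census is its four-down stratum plus an explicit cubic).

References: hexagonal-lattice SAW [DuminilCopinSmirnov2012]; wall-renewal (irreducible bridge) decomposition
[MadrasSlade1993, §4.2 (Definition 4.2.1, p. 90; (4.2.2)), §1.2 (Definition 1.2.4, p. 11)]; enumeration by profile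
[EntingJensen2009, §7.4.2, Fig. 7.10].
-/

namespace Literature.Probability.RandomPlanarGeometry.SAW.HexBW.Wall

open Finset Filter Function
open Literature.Probability.LatticeModels Literature.Probability.Percolation SimpleGraph

variable {n : ℕ} {ω : ℕ → Site 2}

/-- [folklore] Sorting a four-element set of naturals. -/
private theorem sort_four (S : Finset ℕ) (hS : #S = 4) : ∃ a b c d, a < b ∧ b < c ∧ c < d ∧ S = {a, b, c, d} := by
  classical
  have hne : S.Nonempty := by rw [← Finset.card_pos]; omega
  have hdS : S.max' hne ∈ S := Finset.max'_mem S hne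
  have h3 : #(S.erase (S.max' hne)) = 3 := by rw [Finset.card_erase_of_mem hdS, hS]
  obtain ⟨x, y, z, hxy, hxz, hyz, hE⟩ := Finset.card_eq_three.1 h3
  have hlt : ∀ u, u ∈ S.erase (S.max' hne) → u < S.max' hne := fun u hu =>
    lt_of_le_of_ne (S.le_max' u (Finset.mem_of_mem_erase hu)) (Finset.ne_of_mem_erase hu)
  have hx := hlt x (by rw [hE]; simp)
  have hy := hlt y (by rw [hE]; simp)
  have hz := hlt z (by rw [hE]; simp)
  refine ⟨min x (min y z), x + y + z - min x (min y z) - max x (max y z), max x (max y z), S.max' hne, ?_, ?_, ?_, ?_⟩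
  · rcases Nat.lt_or_gt_of_ne hxy with h | h <;> rcases Nat.lt_or_gt_of_ne hxz with h' | h' <;>
      rcases Nat.lt_or_gt_of_ne hyz with h'' | h'' <;> omega
  · rcases Nat.lt_or_gt_of_ne hxy with h | h <;> rcases Nat.lt_or_gt_of_ne hxz with h' | h' <;>
      rcases Nat.lt_or_gt_of_ne hyz with h'' | h'' <;> omega
  · rcases Nat.lt_or_gt_of_ne hxy with h | h <;> rcases Nat.lt_or_gt_of_ne hxz with h' | h' <;>
      rcases Nat.lt_or_gt_of_ne hyz with h'' | h'' <;> omega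
  · have hS' : S = insert (S.max' hne) (S.erase (S.max' hne)) := (Finset.insert_erase hdS).symm
    conv_lhs => rw [hS', hE]
    ext t
    simp only [Finset.mem_insert, Finset.mem_singleton]
    rcases Nat.lt_or_gt_of_ne hxy with h | h <;> rcases Nat.lt_or_gt_of_ne hxz with h' | h' <;>
      rcases Nat.lt_or_gt_of_ne hyz with h'' | h'' <;> omega

/-- [folklore] The number of elements `< t` of a sorted four-element set, as a sum of indicators (cf. the private
`card_filter_lt_four` of `…SAWIrreducibleBridgeTwoSlack` and `htriple` inside `profile_of_card_stepsD_eq_three`). -/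
private theorem card_filter_lt_sorted_four {x y z w : ℕ} (hxy : x < y) (hyz : y < z) (hzw : z < w) (t : ℕ) :
    (#(({x, y, z, w} : Finset ℕ).filter (· < t)) : ℤ) =
      (if x < t then 1 else 0) + (if y < t then 1 else 0) + (if z < t then 1 else 0) + (if w < t then 1 else 0) := by
  rw [Finset.filter_insert, Finset.filter_insert, Finset.filter_insert, Finset.filter_singleton]
  split_ifs <;> simp [Finset.card_insert_of_notMem, ne_of_lt hxy, ne_of_lt hyz, ne_of_lt hzw, ne_of_lt (hxy.trans hyz),
    ne_of_lt (hyz.trans hzw), ne_of_lt (hxy.trans (hyz.trans hzw))]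

/-- **Four down steps: the vertical profile.**  For an irreducible positive wall bridge with exactly four down and four up
steps: the down times `p₁ < p₂ < p₃ < p₄` and up times `r₁ < r₂ < r₃ < r₄` with `pᵢ < rᵢ` (the walk stays in `Y ≤ 0`),
the initial rightward wall run up to the first dive at the odd time `p₁ ≥ 1`, all other steps horizontal, and the height
formula.  Four-down analogue of `profile_of_card_stepsD_eq_three` (tool for the four-down stratum at slack four). OURS
(routine). [cite: MadrasSlade1993, §4.2, Definition 4.2.1 (p. 90), (4.2.2)] [cite: EntingJensen2009, §7.4.2, Fig. 7.10] -/
theorem profile_of_card_stepsD_eq_four (hω : ω ∈ ipwb n) (hD : #(stepsD n ω) = 4) (hU : #(stepsU n ω) = 4) :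
    ∃ p₁ p₂ p₃ p₄ r₁ r₂ r₃ r₄, stepsD n ω = {p₁, p₂, p₃, p₄} ∧ stepsU n ω = {r₁, r₂, r₃, r₄} ∧ p₁ < p₂ ∧ p₂ < p₃ ∧
      p₃ < p₄ ∧ r₁ < r₂ ∧ r₂ < r₃ ∧ r₃ < r₄ ∧ p₁ < r₁ ∧ p₂ < r₂ ∧ p₃ < r₃ ∧ p₄ < r₄ ∧ 1 ≤ p₁ ∧ p₁ % 2 = 1 ∧
      (∀ i, i ≤ p₁ → ω i 0 = i ∧ ω i 1 = 0) ∧ ω (p₁ + 1) 0 = p₁ ∧ ω (p₁ + 1) 1 = -1 ∧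
      (∀ i, i < n → i ∉ stepsD n ω → i ∉ stepsU n ω →
        ω (i + 1) 1 = ω i 1 ∧ (ω (i + 1) 0 = ω i 0 + 1 ∨ ω (i + 1) 0 = ω i 0 - 1)) ∧
      (∀ t, t ≤ n → ω t 1 =
        ((if r₁ < t then 1 else 0) + (if r₂ < t then 1 else 0) + (if r₃ < t then 1 else 0) + (if r₄ < t then 1 else 0)) -
        ((if p₁ < t then 1 else 0) + (if p₂ < t then 1 else 0) + (if p₃ < t then 1 else 0) + (if p₄ < t then 1 else 0))) := by
  classical
  obtain ⟨hp, hn1, -⟩ := mem_ipwb.1 hω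
  obtain ⟨hw, hb⟩ := mem_pwb.1 hp
  obtain ⟨ha, -⟩ := mem_wbr.1 hw
  obtain ⟨hh, -, -⟩ := mem_archs.1 ha
  obtain ⟨hs, hhp⟩ := mem_hpw.1 hh
  obtain ⟨h0, -, hbw, hinj⟩ := mem_saws_iff.1 hs
  have hX0 : ω 0 0 = 0 := by rw [h0]; rfl
  have hY0 : ω 0 1 = 0 := by rw [h0]; rfl
  have hb' : ∀ i, 1 ≤ i → i ≤ n → 0 < ω i 0 ∧ ω i 0 ≤ ω n 0 := fun i h1 h2 => by
    have := hb i h1 h2; rwa [hX0] at this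
  obtain ⟨p₁, p₂, p₃, p₄, h12, h23, h34, hDs⟩ := sort_four _ hD
  obtain ⟨r₁, r₂, r₃, r₄, hr12, hr23, hr34, hUs⟩ := sort_four _ hU
  obtain ⟨hpn1, hpx1, hpy1, hppar1⟩ := of_mem_stepsD_coord hbw (i := p₁) (by rw [hDs]; simp)
  obtain ⟨hpn2, hpx2, hpy2, -⟩ := of_mem_stepsD_coord hbw (i := p₂) (by rw [hDs]; simp)
  obtain ⟨hpn3, hpx3, hpy3, -⟩ := of_mem_stepsD_coord hbw (i := p₃) (by rw [hDs]; simp)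
  obtain ⟨hpn4, hpx4, hpy4, -⟩ := of_mem_stepsD_coord hbw (i := p₄) (by rw [hDs]; simp)
  obtain ⟨hrn1, hrx1, hry1, -⟩ := of_mem_stepsU_coord hbw (i := r₁) (by rw [hUs]; simp)
  obtain ⟨hrn2, hrx2, hry2, -⟩ := of_mem_stepsU_coord hbw (i := r₂) (by rw [hUs]; simp)
  obtain ⟨hrn3, hrx3, hry3, -⟩ := of_mem_stepsU_coord hbw (i := r₃) (by rw [hUs]; simp)
  obtain ⟨hrn4, hrx4, hry4, -⟩ := of_mem_stepsU_coord hbw (i := r₄) (by rw [hUs]; simp)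
  have hhor : ∀ i, i < n → i ∉ stepsD n ω → i ∉ stepsU n ω →
      ω (i + 1) 1 = ω i 1 ∧ (ω (i + 1) 0 = ω i 0 + 1 ∨ ω (i + 1) 0 = ω i 0 - 1) := fun i hi hiD hiU =>
    step_horizontal_of_not_mem hbw hi hiU hiD
  have hYt : ∀ t, t ≤ n → ω t 1 =
      ((if r₁ < t then 1 else 0) + (if r₂ < t then 1 else 0) + (if r₃ < t then 1 else 0) + (if r₄ < t then 1 else 0)) -
      ((if p₁ < t then 1 else 0) + (if p₂ < t then 1 else 0) + (if p₃ < t then 1 else 0) + (if p₄ < t then 1 else 0)) :=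
    fun t ht => by
    rw [apply_one_eq_card_stepsU_sub_card_stepsD hbw hY0 ht, hUs, hDs, card_filter_lt_sorted_four hr12 hr23 hr34,
      card_filter_lt_sorted_four h12 h23 h34]
  -- a down time is not an up time
  have hne : ∀ {a b : ℕ}, ω (a + 1) 1 = ω a 1 - 1 → ω (b + 1) 1 = ω b 1 + 1 → a ≠ b := by
    intro a b ha hb h; rw [h] at ha; omega
  have h1 : p₁ < r₁ := by
    have hy := hYt (r₁ + 1) (by omega); have hle := hhp (r₁ + 1) (by omega)
    have := hne hpy1 hry1; have := hne hpy2 hry1; have := hne hpy3 hry1; have := hne hpy4 hry1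
    rw [if_pos (show r₁ < r₁ + 1 by omega), if_neg (show ¬ r₂ < r₁ + 1 by omega),
      if_neg (show ¬ r₃ < r₁ + 1 by omega), if_neg (show ¬ r₄ < r₁ + 1 by omega)] at hy
    split_ifs at hy <;> omega
  have h2 : p₂ < r₂ := by
    have hy := hYt (r₂ + 1) (by omega); have hle := hhp (r₂ + 1) (by omega)
    have := hne hpy1 hry2; have := hne hpy2 hry2; have := hne hpy3 hry2; have := hne hpy4 hry2
    rw [if_pos (show r₁ < r₂ + 1 by omega), if_pos (show r₂ < r₂ + 1 by omega),
      if_neg (show ¬ r₃ < r₂ + 1 by omega), if_neg (show ¬ r₄ < r₂ + 1 by omega)] at hy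
    split_ifs at hy <;> omega
  have h3 : p₃ < r₃ := by
    have hy := hYt (r₃ + 1) (by omega); have hle := hhp (r₃ + 1) (by omega)
    have := hne hpy1 hry3; have := hne hpy2 hry3; have := hne hpy3 hry3; have := hne hpy4 hry3
    rw [if_pos (show r₁ < r₃ + 1 by omega), if_pos (show r₂ < r₃ + 1 by omega),
      if_pos (show r₃ < r₃ + 1 by omega), if_neg (show ¬ r₄ < r₃ + 1 by omega)] at hy
    split_ifs at hy <;> omega
  have h4 : p₄ < r₄ := by
    have hy := hYt (r₄ + 1) (by omega); have hle := hhp (r₄ + 1) (by omega)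
    have := hne hpy1 hry4; have := hne hpy2 hry4; have := hne hpy3 hry4; have := hne hpy4 hry4
    rw [if_pos (show r₁ < r₄ + 1 by omega), if_pos (show r₂ < r₄ + 1 by omega),
      if_pos (show r₃ < r₄ + 1 by omega), if_pos (show r₄ < r₄ + 1 by omega)] at hy
    split_ifs at hy <;> omega
  -- run 0: the wall run
  have h10 := first_step_eq hbw hn1 hX0 hY0 hb
  have hp1 : 1 ≤ p₁ := by
    by_contra h
    obtain rfl : p₁ = 0 := by omega
    norm_num at hpx1
    have := (hb' 1 le_rfl hn1).1
    omega
  have hnotD : ∀ i, i < p₁ → i ∉ stepsD n ω := fun i hi h => by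
    rw [hDs] at h; simp only [Finset.mem_insert, Finset.mem_singleton] at h; omega
  have hnotU : ∀ i, i < p₁ → i ∉ stepsU n ω := fun i hi h => by
    rw [hUs] at h; simp only [Finset.mem_insert, Finset.mem_singleton] at h; omega
  obtain ⟨e0, he0, hrun0⟩ := run_const_velocity hinj (a := 0) (b := p₁) (by omega) (by omega)
    (fun i h1' h2' => hhor i (by omega) (hnotD i h2') (hnotU i h2'))
  obtain rfl : e0 = 1 := by
    have := (hrun0 1 (by omega) hp1).1
    rcases he0 with rfl | rfl <;> omega
  have hR0 : ∀ i, i ≤ p₁ → ω i 0 = i ∧ ω i 1 = 0 := fun i hi => by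
    obtain ⟨h1', h2'⟩ := hrun0 i (Nat.zero_le _) hi
    rw [hX0] at h1'; rw [hY0] at h2'
    exact ⟨by omega, h2'⟩
  have hP1x : ω (p₁ + 1) 0 = p₁ := by rw [hpx1, (hR0 p₁ le_rfl).1]
  have hP1y : ω (p₁ + 1) 1 = -1 := by rw [hpy1, (hR0 p₁ le_rfl).2]; rfl
  have hpodd : p₁ % 2 = 1 := by rw [hP1x, hP1y] at hppar1; omega
  exact ⟨p₁, p₂, p₃, p₄, r₁, r₂, r₃, r₄, hDs, hUs, h12, h23, h34, hr12, hr23, hr34, h1, h2, h3, h4, hp1, hpodd, hR0,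
    hP1x, hP1y, hhor, hYt⟩

end Literature.Probability.RandomPlanarGeometry.SAW.HexBW.Wall
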